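import Mathlib
import Summits.BirchSwinnertonDyer.BirchSwinnertonDyer.Theorems.KatoDescentTamePotSupersingularTameLowerFibreAdjointBricksFiveFrattini
import Summits.BirchSwinnertonDyer.BirchSwinnertonDyer.Theorems.KatoDescentTamePotSupersingularTameLowerFibreAdjointBricksFiveLocalRing

/-!
# Bricks for the `GL₂(𝔽₅)`-lifting route (T5′), XII: the reduction (C3)(a) at finite level and the
# headline finite-level statement (no `det` normalisation)

Continuation of file XI (`…AdjointBricksFiveLocalRing`, same namespace). File XI proves (T5′) at every finite
level of every finite local ring `A` with residue field `𝔽₅` for subgroups `H ≤ GL₂(A)` normalised by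
`(det h)⁴ = 1` (`S^μ` currency). ARM-P r07 S7 ADD-1 §C (C3)(a) removes the normalisation: the subgroup
`H♮ = {h ∈ H : (det h)⁴ = 1}` is the kernel of `h ↦ (det h)⁴ ∈ 1 + 𝔪`, a `5`-group, so `res(H♮)` is a normal
subgroup of `res(H) = GL₂(𝔽₅)` of `5`-power index — hence everything (file V
`eq_top_of_normal_of_index_eq_pow_five`). This file proves it at finite level:

* `isPGroup_ker_units_map_res` — the principal units `{x ∈ Aˣ : res x = 1}` of a finite local ring with
  residue field `𝔽₅` form a `5`-group (an element of order prime to `5` is `1`: `(ζ − 1)·Σ ζⁱ = ζⁿ − 1 = 0`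
  with `Σ_{i<n} ζⁱ ≡ n` a unit);
* `exists_mem_detPowFour_map_eq` — if `res(H) = GL₂(𝔽₅)` then already `res(H♮) = GL₂(𝔽₅)`;
* `exists_conj_smu_le_of_residual_GL2` — **(T5′) at every finite level, residue field `𝔽₅`: `A` finite
  with `res : A → 𝔽₅` (units = non-zero residue), characteristic `5^{m+1}`; every `H ≤ GL₂(A)` whose
  reduction is all of `GL₂(𝔽₅)` contains `u · S^μ(ℤ/5^{m+1}) · u⁻¹` for some `u ≡ 1 (mod 𝔪)`**, and
  `exists_conj_SL2_le_of_residual_GL2` — **in particular `u · SL₂(ℤ/5^{m+1}) · u⁻¹ ⊆ H`**: Kato's (12.5.2) /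
  Skinner–Urban's lattice shape «`ρ(G) ⊇ SL₂(ℤ_p)` in a suitable basis» at every finite level `𝒪_𝔭/𝔭ⁿ` of
  every Δ1 ring with `f = 1`, from the residual image `GL₂(𝔽₅)` alone — the `(2, 𝔽₅)` case that [M]
  (Manoharmayum 2015) excludes and that is FALSE for residual image `SL₂(𝔽₅)` (Remark 4.4).

Remaining on paper for Δ1 proper: `f ≥ 2`, and (h) the limit. Route-free, no definitions, nothing about
elliptic curves or items 19618/19981 (open). Target T-S7r07-1 (`FibreLatticeInput 5`).
-/

set_option linter.dupNamespace false

open Matrix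

namespace Summit.BirchSwinnertonDyer.BirchSwinnertonDyer.Theorems.GL2F5AdjointBricks

section reduction

universe u

variable {A : Type u} [CommRing A]

/-- **The principal units of a finite local ring with residue field `𝔽₅` form a `5`-group.** For `A` finite
with `res : A → 𝔽₅` such that every element of non-zero residue is a unit, every unit `ζ` with `res ζ = 1`
has `5`-power order: if `ζⁿ = 1` with `5 ∤ n` then `ζ = 1`, because `(ζ − 1) · Σ_{i<n} ζⁱ = ζⁿ − 1 = 0` and
`Σ_{i<n} ζⁱ` has residue `n ≠ 0`. -/
theorem isPGroup_ker_units_map_res [Finite A] (res : A →+* ZMod 5) (hloc : ∀ a, res a ≠ 0 → IsUnit a) :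
    IsPGroup 5 ((Units.map (res : A →* ZMod 5)).ker) := by
  classical
  intro x
  -- decompose the order of `x`
  have ho : orderOf x ≠ 0 := (orderOf_pos x).ne'
  obtain ⟨a, o', ho', hoe⟩ := Nat.exists_eq_pow_mul_and_not_dvd ho 5 (by norm_num)
  refine ⟨a, ?_⟩
  set z := x ^ 5 ^ a with hz
  have hzo : z ^ o' = 1 := by rw [hz, ← pow_mul, ← hoe, pow_orderOf_eq_one]
  -- `ζ = z` as an element of `A` has residue `1`
  set ζ : A := (((z : (Units.map (res : A →* ZMod 5)).ker) : Aˣ) : A) with hζ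
  have hζres : res ζ = 1 := by
    have h := (z : (Units.map (res : A →* ZMod 5)).ker).prop
    rw [MonoidHom.mem_ker] at h
    have h' := congrArg (fun y : (ZMod 5)ˣ => (y : ZMod 5)) h
    simpa only [Units.coe_map, MonoidHom.coe_coe, Units.val_one] using h'
  have hζo : ζ ^ o' = 1 := by
    have h := congrArg (fun y : (Units.map (res : A →* ZMod 5)).ker => ((y : Aˣ) : A)) hzo
    simpa only [SubmonoidClass.coe_pow, Units.val_pow_eq_pow_val, OneMemClass.coe_one, Units.val_one] using h
  -- the geometric sum is a unit
  have hS : IsUnit (∑ i ∈ Finset.range o', ζ ^ i) := by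
    apply hloc
    rw [map_sum]
    simp only [map_pow, hζres, one_pow, Finset.sum_const, Finset.card_range, nsmul_eq_mul, mul_one]
    rw [Ne, CharP.cast_eq_zero_iff (ZMod 5) 5]
    exact ho'
  have hζ1 : ζ = 1 := by
    have h := geom_sum_mul ζ o'
    rw [hζo, sub_self] at h
    obtain ⟨w, hw⟩ := hS
    rw [← hw] at h
    have h2 : ζ - 1 = 0 := by
      calc ζ - 1 = ↑w⁻¹ * (↑w * (ζ - 1)) := by rw [← mul_assoc, Units.inv_mul, one_mul]
        _ = 0 := by rw [h, mul_zero]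
    exact sub_eq_zero.1 h2
  apply Subtype.ext
  apply Units.ext
  rw [← hζ]
  simpa using hζ1

/-- **(C3)(a) at finite level.** If `H ≤ GL₂(A)` (`A` finite local with residue field `𝔽₅` via `res`) has
reduction all of `GL₂(𝔽₅)`, then so does `H♮ = {h ∈ H : (det h)⁴ = 1}`: `H♮` is the kernel of
`h ↦ (det h)⁴`, which lands in the principal units (a `5`-group), so `res(H♮) ◁ GL₂(𝔽₅)` has `5`-power
index, and `GL₂(𝔽₅)` has no proper normal subgroup of `5`-power index (file V). -/
theorem exists_mem_detPowFour_map_eq [Finite A] (res : A →+* ZMod 5) (hloc : ∀ a, res a ≠ 0 → IsUnit a)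
    (H : Subgroup (GL (Fin 2) A))
    (hres : ∀ q : GL (Fin 2) (ZMod 5), ∃ h ∈ H, Matrix.GeneralLinearGroup.map res h = q)
    (q : GL (Fin 2) (ZMod 5)) :
    ∃ h ∈ H, Matrix.det (h : Matrix (Fin 2) (Fin 2) A) ^ 4 = 1 ∧ Matrix.GeneralLinearGroup.map res h = q := by
  classical
  haveI : Fact (Nat.Prime 5) := ⟨by norm_num⟩
  set ρ := Matrix.GeneralLinearGroup.map (n := Fin 2) res with hρ
  -- `φ h = (det h)⁴ ∈ Aˣ`, restricted to `H`
  set φ : GL (Fin 2) A →* Aˣ := (powMonoidHom 4).comp Matrix.GeneralLinearGroup.det with hφ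
  set φH : H →* Aˣ := φ.comp H.subtype with hφH
  set resH : H →* GL (Fin 2) (ZMod 5) := ρ.comp H.subtype with hresH
  have hsurj : Function.Surjective resH := by
    intro q'
    obtain ⟨h, hh, hq⟩ := hres q'
    exact ⟨⟨h, hh⟩, hq⟩
  -- the range of `φH` lies in the principal units, a `5`-group
  set T : Subgroup Aˣ := (Units.map (res : A →* ZMod 5)).ker with hT
  have hrange : φH.range ≤ T := by
    rintro x ⟨h, rfl⟩
    rw [hT, MonoidHom.mem_ker]
    apply Units.ext
    have hval : ((Units.map (res : A →* ZMod 5)) (φH h) : ZMod 5) =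
        res (Matrix.det ((h : GL (Fin 2) A) : Matrix (Fin 2) (Fin 2) A)) ^ 4 := by
      simp only [hφH, hφ, MonoidHom.coe_comp, Function.comp_apply, Subgroup.coe_subtype, powMonoidHom_apply,
        Units.coe_map, MonoidHom.coe_coe, Units.val_pow_eq_pow_val, Matrix.GeneralLinearGroup.val_det_apply,
        map_pow]
    rw [hval, Units.val_one]
    have hne : res (Matrix.det ((h : GL (Fin 2) A) : Matrix (Fin 2) (Fin 2) A)) ≠ 0 := by
      have hu : IsUnit (Matrix.det ((h : GL (Fin 2) A) : Matrix (Fin 2) (Fin 2) A)) := by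
        rw [← Matrix.GeneralLinearGroup.val_det_apply]; exact Units.isUnit _
      haveI : Fact (1 < 5) := ⟨by norm_num⟩
      exact (hu.map res).ne_zero
    have h4 := ZMod.pow_card_sub_one_eq_one hne
    simpa using h4
  obtain ⟨e, he⟩ := (IsPGroup.iff_card).1 (isPGroup_ker_units_map_res res hloc)
  have hcardR : Nat.card φH.range ∣ 5 ^ e := by
    rw [← he]
    exact Subgroup.card_dvd_of_le hrange
  -- `N = res(H♮)` is normal of `5`-power index in `GL₂(𝔽₅)`, hence everything
  set K' : Subgroup H := φH.ker with hK'
  set N : Subgroup (GL (Fin 2) (ZMod 5)) := K'.map resH with hN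
  haveI hNn : N.Normal := Subgroup.Normal.map inferInstance resH hsurj
  have hNidx : N.index ∣ 5 ^ e := by
    refine (Subgroup.index_map_dvd K' hsurj).trans ?_
    rw [hK', Subgroup.index_ker]
    exact hcardR
  obtain ⟨j, -, hj⟩ := (Nat.dvd_prime_pow (by norm_num : Nat.Prime 5)).1 hNidx
  have hNtop : N = ⊤ := eq_top_of_normal_of_index_eq_pow_five N j hj
  have hq : q ∈ N := by rw [hNtop]; exact Subgroup.mem_top q
  obtain ⟨x, hx, hxq⟩ := Subgroup.mem_map.1 hq
  refine ⟨(x : GL (Fin 2) A), x.prop, ?_, hxq⟩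
  rw [hK', MonoidHom.mem_ker] at hx
  have h := congrArg (fun y : Aˣ => (y : A)) hx
  simpa only [hφH, hφ, MonoidHom.coe_comp, Function.comp_apply, Subgroup.coe_subtype, powMonoidHom_apply,
    Units.val_pow_eq_pow_val, Matrix.GeneralLinearGroup.val_det_apply, Units.val_one] using h

/-- **(T5′) at every finite level for residue field `𝔽₅` (ARM-P r07 S7 ADD-1 §C (C0), finite-level form; the
`(2, 𝔽₅)` case of Manoharmayum's theorem for residual image `GL₂(𝔽₅)`).** Let `A` be a finite commutative
ring with a ring map `res : A → 𝔽₅` such that every element of non-zero residue is a unit (a finite local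
ring with residue field `𝔽₅`), of characteristic `5^{m+1}`, and let `H ≤ GL₂(A)` be any subgroup whose
reduction is all of `GL₂(𝔽₅)`. Then `u · S^μ(ℤ/5^{m+1}) · u⁻¹ ⊆ H` for some `u ∈ GL₂(A)` with `res(u) = 1`,
where `S^μ(ℤ/5^{m+1}) = {g ∈ GL₂(ℤ/5^{m+1}) : (det g)⁴ = 1} ⊇ SL₂(ℤ/5^{m+1})`. -/
theorem exists_conj_smu_le_of_residual_GL2 (A : Type u) [CommRing A] [Finite A]
    (res : A →+* ZMod 5) (hloc : ∀ a, res a ≠ 0 → IsUnit a) (m : ℕ) [CharP A (5 ^ (m + 1))]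
    (H : Subgroup (GL (Fin 2) A))
    (hres : ∀ q : GL (Fin 2) (ZMod 5), ∃ h ∈ H, Matrix.GeneralLinearGroup.map res h = q) :
    ∃ u : GL (Fin 2) A, Matrix.GeneralLinearGroup.map res u = 1 ∧
      ∀ g : GL (Fin 2) (ZMod (5 ^ (m + 1))),
        Matrix.det (g : Matrix (Fin 2) (Fin 2) (ZMod (5 ^ (m + 1)))) ^ 4 = 1 →
          u * Matrix.GeneralLinearGroup.map (ZMod.castHom (dvd_refl (5 ^ (m + 1))) A) g * u⁻¹ ∈ H := by
  classical
  -- the normalised subgroup `H♮ = {h ∈ H : (det h)⁴ = 1}`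
  set φ : GL (Fin 2) A →* Aˣ := (powMonoidHom 4).comp Matrix.GeneralLinearGroup.det with hφ
  set Hn : Subgroup (GL (Fin 2) A) := H ⊓ φ.ker with hHn
  have hHnmem : ∀ h, h ∈ Hn ↔ h ∈ H ∧ Matrix.det (h : Matrix (Fin 2) (Fin 2) A) ^ 4 = 1 := by
    intro h
    rw [hHn, Subgroup.mem_inf, MonoidHom.mem_ker, hφ]
    constructor
    · rintro ⟨hh, hk⟩
      refine ⟨hh, ?_⟩
      have e := congrArg (fun y : Aˣ => (y : A)) hk
      simpa only [MonoidHom.coe_comp, Function.comp_apply, powMonoidHom_apply, Units.val_pow_eq_pow_val,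
        Matrix.GeneralLinearGroup.val_det_apply, Units.val_one] using e
    · rintro ⟨hh, hd⟩
      refine ⟨hh, Units.ext ?_⟩
      simpa only [MonoidHom.coe_comp, Function.comp_apply, powMonoidHom_apply, Units.val_pow_eq_pow_val,
        Matrix.GeneralLinearGroup.val_det_apply, Units.val_one] using hd
  have hHnμ : ∀ h ∈ Hn, Matrix.det (h : Matrix (Fin 2) (Fin 2) A) ^ 4 = 1 := fun h hh => ((hHnmem h).1 hh).2
  have hresn : ∀ q : GL (Fin 2) (ZMod 5), ∃ h ∈ Hn, Matrix.GeneralLinearGroup.map res h = q := by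
    intro q
    obtain ⟨h, hh, hd, hq⟩ := exists_mem_detPowFour_map_eq res hloc H hres q
    exact ⟨h, (hHnmem h).2 ⟨hh, hd⟩, hq⟩
  obtain ⟨u, hu1, hu⟩ := exists_conj_smu_le_of_residual A res hloc m Hn hHnμ hresn
  exact ⟨u, hu1, fun g hg => ((hHnmem _).1 (hu g hg)).1⟩

/-- **Corollary: a conjugate of `SL₂(ℤ/5^{m+1})` inside `H`.** Under the hypotheses of
`exists_conj_smu_le_of_residual_GL2`, `u · SL₂(ℤ/5^{m+1}) · u⁻¹ ⊆ H` for some `u` with `res(u) = 1` —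
Kato's (12.5.2) / Skinner–Urban's «image contains `SL₂(ℤ_p)` in a suitable basis» at the finite level
`𝒪_𝔭/𝔭ⁿ` (`f = 1`), from residual image `GL₂(𝔽₅)` alone. -/
theorem exists_conj_SL2_le_of_residual_GL2 (A : Type u) [CommRing A] [Finite A]
    (res : A →+* ZMod 5) (hloc : ∀ a, res a ≠ 0 → IsUnit a) (m : ℕ) [CharP A (5 ^ (m + 1))]
    (H : Subgroup (GL (Fin 2) A))
    (hres : ∀ q : GL (Fin 2) (ZMod 5), ∃ h ∈ H, Matrix.GeneralLinearGroup.map res h = q) :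
    ∃ u : GL (Fin 2) A, Matrix.GeneralLinearGroup.map res u = 1 ∧
      ∀ g : Matrix.SpecialLinearGroup (Fin 2) (ZMod (5 ^ (m + 1))),
        u * Matrix.GeneralLinearGroup.map (ZMod.castHom (dvd_refl (5 ^ (m + 1))) A)
          (Matrix.SpecialLinearGroup.toGL g) * u⁻¹ ∈ H := by
  obtain ⟨u, hu1, hu⟩ := exists_conj_smu_le_of_residual_GL2 A res hloc m H hres
  refine ⟨u, hu1, fun g => hu _ ?_⟩
  rw [Matrix.SpecialLinearGroup.coe_GL_coe_matrix, g.prop, one_pow]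

end reduction

end Summit.BirchSwinnertonDyer.BirchSwinnertonDyer.Theorems.GL2F5AdjointBricks
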